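import Summits.BirchSwinnertonDyer.BirchSwinnertonDyer.Theorems.ByReductionTypeAtTwoSupersingularFlatBlindTwistTamagawaAtTwo
import Summits.BirchSwinnertonDyer.BirchSwinnertonDyer.Theorems.ByReductionTypeAtTwoSupersingularTowerTorsionTwo
import Summits.BirchSwinnertonDyer.BirchSwinnertonDyer.Theorems.GenusKolyvaginAtTwoMazurRubinCor34iiDictionary
import Summits.BirchSwinnertonDyer.Rank1Residual.Additive.KatoDescentStrictSelmerLevel
import Summits.BirchSwinnertonDyer.Rank1Residual.Additive.PadicLogFormalGroup
import Summits.BirchSwinnertonDyer.Rank1Residual.X11b.Three.GoodReductionSubgroupCuspPadic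
import Literature.NumberTheory.EllipticCurves.LocalPointsPlaceTransportProofs
import Literature.NumberTheory.DiophantineGeometry.TateAlgorithmAdditiveProofs
import HarnessLib

/-!
# Route `ByReductionTypeAtTwo` (rung K4), crux `SupersingularRankZeroAtTwo` (item stmt-BirchSwinnertonDyer-19097), line
# `odd_blind_package` slot 5 (CDC_H `OddBlindPackage.FlatBlindControlCardHondaAtTwo`): the CURVE SIDE of the twist `W₂ = E^{(2)}` at `2` —
# **no `2`-torsion in `W₂(ℚ₂)`, additive reduction, `log_ω(W₂(ℚ₂)) = ℤ₂`, and the normalised functional `λ = log_ω`**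
# (cell `bsd-2adic`, LEAD ss-1 GEN 21; memo `HOME/ss/gen21/HAND-TARGETS-CDC-2.md` §1 step 8 / §3)

HONEST FRAMING: THEOREMS ONLY (no definition, no named fact, no `sorry`, no instance); a helper
(`--supports stmt-BirchSwinnertonDyer-19097`): it does NOT prove CDC_H or the crux; nothing booked; BSD is proved for no curve by any of
this. bears_on: K4 (19097).

## What is proved (for `W/ℚ` globally minimal with `GoodSS W 2` and an elliptic model `W₂` of its quadratic twist by `2`)

* `forall_two_nsmul_eq_zero_padic_twist_of_goodSS` — `W₂(ℚ₂)[2] = 0` (`#W₂(ℚ₂)[2] = #W(ℚ₂)[2]`, tree `natCard_twoTorsion_padic_twist_eq`, and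
  `W(ℚ₂)[2] = 0` on the supersingular line, tree `SSFlatEC.two_nsmul_eq_zero_padic_of_goodSS_two`); `…_adicCompletion_…` (at the place `v ∋ 2`);
  `padicValNat_two_natCard_torsion_padic_twist_eq_zero` (`#W₂(ℚ₂)_tors` is odd or infinite-as-`0`: `v₂ = 0`).
* `hasAdditiveReduction_padic_twist_of_goodSS` — `W₂ ⊗ ℚ₂` (the global minimal equation itself) has ADDITIVE reduction over `ℤ₂` (Kodaira II at
  `2`, ★ p813944 `kodairaSymbol_twist_two_of_goodSS`, is neither `I₀` nor `Iₙ`: `isAdditive_kodairaSymbolOfMinimal_iff`; moved to the global minimal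
  equation by `Three.JetchevKummer.hasAdditiveReduction_baseChange_padic_of_not_good_of_not_mult`).
* ★ `range_padicLog_padic_twist_of_goodSS` — **`log_ω(W₂(ℚ₂)) = ℤ₂`**: the tree's `log(E(ℚ_p)) = p^{t − v_p c_p} ℤ_p` at an additive prime
  (`LocalLog.range_padicLog_eq_span_zpow_of_hasAdditiveReduction`, ANY `p`) with `t = v₂ #W₂(ℚ₂)_tors = 0` and `c₂(W₂) = 1` (★ p813944).
* ★ `exists_normalized_functional_twist_of_goodSS` — a NORMALISED functional `λ : W₂(ℚ₂) →+ ℤ₂` (surjective, kernel = torsion) WITH `λ = log_ω`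
  on the nose (`StrictCount.exists_hom_padicInt_of_range_padicLog` at `e = 0`): the `lam` of HT-C2 (★★ p812748) for which `ι(P₁) = v₂ log_ω(P₁)`.
* `padicLogOrd_eq_valuation_of_normalized` — for that `λ` and every `P ∈ W₂(K)` read in `W₂(ℚ₂)` along `ι` with `P_ι` of infinite order:
  `padicLogOrd W₂ 2 ι P = v₂ λ(P_ι)` (tree bridge `LocalLog.padicLogOrd_eq_valuation_padicLog`). This is the log normalisation of the constant audit:
  `padicLogOrd = ι − v₂ c₂(W₂)` with `c₂(W₂) = 1`.

References: [SilvermanAEC2009] IV.6.4, VII.6.1, VII.6.3, X.5 Cor. 5.4; [Kim2022StructureSelmer] §3.2.3 and Lemma 3.10; [MazurRubin2010] Remark 2.4;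
[Castella2018] §2.2 (the symbol `log_{ω_E}`); [BarriosEtAl2025] Thm. 5.1 (row I₀, `v(d) = 1`, `v(a₁) ≥ 1`).
-/

set_option autoImplicit false
set_option linter.dupNamespace false

noncomputable section

open scoped Classical NumberField

namespace Summit.BirchSwinnertonDyer.BirchSwinnertonDyer.Theorems

namespace OddBlindLocal

open NumberField IsDedekindDomain IsLocalRing WeierstrassCurve Literature.NumberTheory.EllipticCurves
  Literature.NumberTheory.EllipticCurves.TwistGoodTwo Literature.NumberTheory.EllipticCurves.Rank1Residual
  Literature.NumberTheory.DiophantineGeometry Summit.BirchSwinnertonDyer.Rank1Residual.Additive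
open IsDiscreteValuationRing hiding maximalIdeal

/-! ## §1 No `2`-torsion in `W₂(ℚ₂)` -/

/-- **`W₂(ℚ₂)[2] = 0`** for every elliptic model `W₂` of the quadratic twist by `2` of a globally minimal `W` with `GoodSS W 2`: the twist does not change the
number of `2`-torsion points over `ℚ₂` (`natCard_twoTorsion_padic_twist_eq`), and `W(ℚ₂)[2] = 0` on the supersingular line
(`SSFlatEC.two_nsmul_eq_zero_padic_of_goodSS_two`). [cite: MazurRubin2010, Remark 2.4] [cite: SilvermanAEC2009, X.5 Cor. 5.4 and VII.3.1] -/
theorem forall_two_nsmul_eq_zero_padic_twist_of_goodSS (W : WeierstrassCurve ℚ) [W.IsElliptic] [W.IsGloballyMinimal] (hss : GoodSS W 2)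
    (W₂ : WeierstrassCurve ℚ) [W₂.IsElliptic] (htw : ∃ C : WeierstrassCurve.VariableChange ℚ, C • W.quadraticTwist 2 = W₂) :
    ∀ Q : (W₂.baseChange ℚ_[2]).toAffine.Point, 2 • Q = 0 → Q = 0 := by
  obtain ⟨C, hC⟩ := htw
  have hcard := GenusKolyTwistTamagawa.natCard_twoTorsion_padic_twist_eq W (two_ne_zero (α := ℚ)) hC 2
  have hone : Nat.card {Q : (W.baseChange ℚ_[2]).toAffine.Point // 2 • Q = 0} = 1 := by
    rw [Nat.card_eq_one_iff_unique]
    exact ⟨⟨fun a b ↦ Subtype.ext ((SSFlatEC.two_nsmul_eq_zero_padic_of_goodSS_two W hss a.1 a.2).trans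
      (SSFlatEC.two_nsmul_eq_zero_padic_of_goodSS_two W hss b.1 b.2).symm)⟩, ⟨⟨0, nsmul_zero 2⟩⟩⟩
  rw [hone, Nat.card_eq_one_iff_unique] at hcard
  intro Q hQ
  have h := hcard.1.elim ⟨Q, hQ⟩ ⟨0, nsmul_zero 2⟩
  exact congrArg Subtype.val h

/-- **`W₂(ℚ_v)[2] = 0` at the place `v ∋ 2` of `ℚ`** (the same through `ℚ_v ≃ₐ ℚ₂`, tree `forall_nsmul_eq_zero_adicCompletion_iff_padic`).
[cite: MazurRubin2010, Remark 2.4] [cite: SilvermanAEC2009, X.5 Cor. 5.4] -/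
theorem forall_two_nsmul_eq_zero_adicCompletion_twist_of_goodSS (W : WeierstrassCurve ℚ) [W.IsElliptic] [W.IsGloballyMinimal]
    (hss : GoodSS W 2) (W₂ : WeierstrassCurve ℚ) [W₂.IsElliptic] (htw : ∃ C : WeierstrassCurve.VariableChange ℚ, C • W.quadraticTwist 2 = W₂)
    (v : HeightOneSpectrum (𝓞 ℚ)) (hv : (2 : 𝓞 ℚ) ∈ v.asIdeal) :
    ∀ Q : (W₂.baseChange (v.adicCompletion ℚ)).toAffine.Point, 2 • Q = 0 → Q = 0 :=
  (W₂.forall_nsmul_eq_zero_adicCompletion_iff_padic (p := 2) (by exact_mod_cast hv) 2).mpr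
    (forall_two_nsmul_eq_zero_padic_twist_of_goodSS W hss W₂ htw)

/-- **`v₂ #W₂(ℚ₂)_tors = 0`**: the torsion subgroup of `W₂(ℚ₂)` has no element of order `2`, so its order is odd (Cauchy) — or it is read as `0`
by `Nat.card` if infinite, with `v₂ 0 = 0`. [cite: SilvermanAEC2009, VII.3.1] -/
theorem padicValNat_two_natCard_torsion_padic_twist_eq_zero (W : WeierstrassCurve ℚ) [W.IsElliptic] [W.IsGloballyMinimal] (hss : GoodSS W 2)
    (W₂ : WeierstrassCurve ℚ) [W₂.IsElliptic] (htw : ∃ C : WeierstrassCurve.VariableChange ℚ, C • W.quadraticTwist 2 = W₂) :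
    padicValNat 2 (Nat.card (AddCommGroup.torsion (W₂.baseChange ℚ_[2]).toAffine.Point)) = 0 := by
  by_cases hfin : Finite (AddCommGroup.torsion (W₂.baseChange ℚ_[2]).toAffine.Point)
  · refine padicValNat.eq_zero_of_not_dvd fun hdvd ↦ ?_
    haveI : Fact (Nat.Prime 2) := ⟨Nat.prime_two⟩
    obtain ⟨t, ht⟩ := exists_prime_addOrderOf_dvd_card' (G := AddCommGroup.torsion (W₂.baseChange ℚ_[2]).toAffine.Point) 2 hdvd
    have h2t' : 2 • t = 0 := addOrderOf_dvd_iff_nsmul_eq_zero.mp (by rw [ht])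
    have h2t : 2 • (t : (W₂.baseChange ℚ_[2]).toAffine.Point) = 0 := by
      rw [← AddSubgroupClass.coe_nsmul, h2t', ZeroMemClass.coe_zero]
    have ht0 : t = 0 := Subtype.ext (forall_two_nsmul_eq_zero_padic_twist_of_goodSS W hss W₂ htw _ h2t)
    rw [ht0, addOrderOf_zero] at ht
    exact absurd ht (by decide)
  · haveI := not_finite_iff_infinite.mp hfin
    rw [Nat.card_eq_zero_of_infinite, padicValNat_zero_right]

/-! ## §2 Additive reduction of `W₂ ⊗ ℚ₂` -/

/-- **`W₂ ⊗ ℚ₂` has ADDITIVE reduction over `ℤ₂`** (the global minimal equation itself): its Kodaira symbol is II (★ p813944), which is neither `I₀`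
(so the minimal model is not of good reduction, `kodairaSymbol_eq_I_zero_iff`) nor an `Iₙ` (so it is not multiplicative: an additive symbol forces
`π ∣ c₄` on the integral minimal model, `isAdditive_kodairaSymbolOfMinimal_iff`, against `v(c₄) = 0`); then
`Three.JetchevKummer.hasAdditiveReduction_baseChange_padic_of_not_good_of_not_mult`. [cite: SilvermanATAEC1994, IV.9.4 Steps 1–3 and Table 4.1]
[cite: SilvermanAEC2009, VII.5 Prop. 5.1] -/
theorem hasAdditiveReduction_padic_twist_of_goodSS (W : WeierstrassCurve ℚ) [W.IsElliptic] [W.IsGloballyMinimal] (hss : GoodSS W 2)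
    (W₂ : WeierstrassCurve ℚ) [W₂.IsElliptic] [W₂.IsGloballyMinimal]
    (htw : ∃ C : WeierstrassCurve.VariableChange ℚ, C • W.quadraticTwist 2 = W₂) :
    (W₂.baseChange ℚ_[2]).HasAdditiveReduction ℤ_[2] := by
  haveI := perfectField_residueField_padicInt
  haveI hX : (W₂.baseChange ℚ_[2]).IsElliptic := by rw [WeierstrassCurve.baseChange]; infer_instance
  have hK := kodairaSymbol_twist_two_of_goodSS W hss W₂ htw
  -- not good
  have hg : ¬ W₂.HasGoodReductionAtPrime 2 := fun h ↦ by
    have h0 := (WeierstrassCurve.kodairaSymbol_eq_I_zero_iff (R := ℤ_[2]) (W₂.baseChange ℚ_[2])).mpr h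
    rw [hK] at h0
    exact absurd h0 (by decide)
  -- not multiplicative: an additive symbol forces `π ∣ c₄` on the integral minimal model
  have hm : ¬ W₂.HasMultiplicativeReductionAtPrime 2 := fun h ↦ by
    set M := (W₂.baseChange ℚ_[2]).minimal ℤ_[2] with hM
    have hΔI : (M.integralModel ℤ_[2]).Δ ≠ 0 := by
      rw [ne_eq, ← _root_.map_eq_zero_iff (algebraMap ℤ_[2] ℚ_[2]) (IsFractionRing.injective _ _),
        WeierstrassCurve.integralModel_Δ_eq, hM, WeierstrassCurve.minimal, WeierstrassCurve.variableChange_Δ]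
      exact mul_ne_zero (pow_ne_zero _ (Units.ne_zero _)) hX.isUnit.ne_zero
    have hminI : ((M.integralModel ℤ_[2]).baseChange ℚ_[2]).IsMinimal ℤ_[2] := by
      rw [WeierstrassCurve.baseChange_integralModel_eq]; infer_instance
    have hadd : (M.integralModel ℤ_[2]).kodairaSymbolOfMinimal.IsAdditive := by
      have hK' : (M.integralModel ℤ_[2]).kodairaSymbolOfMinimal = .II := hK
      rw [hK']
      exact ⟨by decide, fun ⟨n, _, hn⟩ ↦ by cases hn⟩
    obtain ⟨-, hc₄⟩ := (Literature.NumberTheory.DiophantineGeometry.TateAlgorithm.isAdditive_kodairaSymbolOfMinimal_iff (R := ℤ_[2]) ℚ_[2] hΔI hminI).mp hadd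
    have hval := h.multiplicativeReduction
    rw [← WeierstrassCurve.integralModel_c₄_eq ℤ_[2] M, HeightOneSpectrum.valuation_eq_one_iff_notMem] at hval
    exact hval hc₄
  exact Summit.BirchSwinnertonDyer.Rank1Residual.X11b.Three.JetchevKummer.hasAdditiveReduction_baseChange_padic_of_not_good_of_not_mult
    W₂ 2 hg hm

/-! ## §3 `log_ω(W₂(ℚ₂)) = ℤ₂` and the normalised functional -/

/-- ★ **`log_ω(W₂(ℚ₂)) = ℤ₂`**: at an additive prime `log(E(ℚ_p)) = p^{t − v_p c_p} ℤ_p` for every `p` (tree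
`LocalLog.range_padicLog_eq_span_zpow_of_hasAdditiveReduction`), and here `t = v₂ #W₂(ℚ₂)_tors = 0`, `c₂(W₂) = 1` (★ p813944): the
`ℤ₂`-linearly extended formal-group logarithm maps `W₂(ℚ₂)` ONTO `ℤ₂` — the constant `c₀(W₂) = 0` of the CDC audit.
[cite: Kim2022StructureSelmer, §3.2.3 (display before Thm. 3.7) and Lemma 3.10] [cite: SilvermanAEC2009, IV.6.4, VII.6.1, VII.6.3] -/
theorem range_padicLog_padic_twist_of_goodSS (W : WeierstrassCurve ℚ) [W.IsElliptic] [W.IsGloballyMinimal] (hss : GoodSS W 2)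
    (W₂ : WeierstrassCurve ℚ) [W₂.IsElliptic] [W₂.IsGloballyMinimal]
    (htw : ∃ C : WeierstrassCurve.VariableChange ℚ, C • W.quadraticTwist 2 = W₂) :
    (LocalLog.padicLog (W₂.baseChange ℚ_[2])).range = (Submodule.span ℤ_[2] {(2 : ℚ_[2]) ^ (0 : ℤ)}).toAddSubgroup := by
  haveI := hasAdditiveReduction_padic_twist_of_goodSS W hss W₂ htw
  haveI : (W₂.baseChange ℚ_[2]).IsElliptic := by rw [WeierstrassCurve.baseChange]; infer_instance
  have h := LocalLog.range_padicLog_eq_span_zpow_of_hasAdditiveReduction (W₂.baseChange ℚ_[2])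
  rw [padicValNat_two_natCard_torsion_padic_twist_eq_zero W hss W₂ htw, localTamagawaNumber_padic_twist_two_of_goodSS W hss W₂ htw,
    padicValNat_one_right, Nat.cast_zero, Nat.cast_ofNat, sub_zero] at h
  exact h

/-- ★ **The normalised functional `λ = log_ω : W₂(ℚ₂) ↠ ℤ₂`, kernel = torsion.** For the HT-C2 binders (`hlam`, `hsurj`) on the twist: there is
`λ : W₂(ℚ₂) →+ ℤ₂`, surjective, with `λ Q = 0 ↔ Q` torsion, and `(λ Q : ℚ₂) = log_ω Q` for every `Q` (`StrictCount.exists_hom_padicInt_of_range_padicLog`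
at `e = 0`). [cite: SilvermanAEC2009, IV.6.4 and VII.6.3] [cite: Kim2022StructureSelmer, Lemma 3.10] -/
theorem exists_normalized_functional_twist_of_goodSS (W : WeierstrassCurve ℚ) [W.IsElliptic] [W.IsGloballyMinimal] (hss : GoodSS W 2)
    (W₂ : WeierstrassCurve ℚ) [W₂.IsElliptic] [W₂.IsGloballyMinimal]
    (htw : ∃ C : WeierstrassCurve.VariableChange ℚ, C • W.quadraticTwist 2 = W₂) :
    ∃ lam : (W₂.baseChange ℚ_[2]).toAffine.Point →+ ℤ_[2],
      (∀ Q, lam Q = 0 ↔ IsOfFinAddOrder Q) ∧ Function.Surjective lam ∧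
        ∀ Q, ((lam Q : ℤ_[2]) : ℚ_[2]) = LocalLog.padicLog (W₂.baseChange ℚ_[2]) Q := by
  haveI : (W₂.baseChange ℚ_[2]).IsElliptic := by rw [WeierstrassCurve.baseChange]; infer_instance
  obtain ⟨lam, hlam, hsurj, hval⟩ := StrictCount.exists_hom_padicInt_of_range_padicLog (W₂.baseChange ℚ_[2])
    (range_padicLog_padic_twist_of_goodSS W hss W₂ htw)
  refine ⟨lam, hlam, hsurj, fun Q ↦ ?_⟩
  rw [hval Q, neg_zero, zpow_zero, one_mul]

/-- **The log normalisation of the CDC audit: `padicLogOrd W₂ 2 ι P = v₂ λ(P_ι)`** for the normalised `λ = log_ω` and every `P ∈ W₂(K)` (any number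
field `K`, any `ι : K →+* ℚ₂`) whose image `P_ι ∈ W₂(ℚ₂)` has infinite order: the tree's `padicLogOrd` IS `ord₂` of the `ℤ₂`-linearly extended formal
logarithm (`LocalLog.padicLogOrd_eq_valuation_padicLog`), which is `λ`. With `c₂(W₂) = 1` this is the identity `padicLogOrd = ι(P) − v₂ c₂(W₂)` of the
constant audit. [cite: Castella2018, §2.2 and Thm. 2.3 (arXiv:1704.06608 p. 5)] [cite: SilvermanAEC2009, IV.6.4 and VII.6.3] -/
theorem padicLogOrd_eq_valuation_of_normalized (W₂ : WeierstrassCurve ℚ) [W₂.IsElliptic] [W₂.IsGloballyMinimal]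
    {K : Type} [Field K] [NumberField K] (ι : K →+* ℚ_[2]) (P : (W₂.baseChange K).toAffine.Point)
    (hP : ¬ IsOfFinAddOrder (padicPointOf W₂ 2 ι P))
    (lam : (W₂.baseChange ℚ_[2]).toAffine.Point →+ ℤ_[2])
    (hval : ∀ Q, ((lam Q : ℤ_[2]) : ℚ_[2]) = LocalLog.padicLog (W₂.baseChange ℚ_[2]) Q) :
    padicLogOrd W₂ 2 ι P = ((lam (padicPointOf W₂ 2 ι P) : ℤ_[2]) : ℚ_[2]).valuation := by
  rw [hval]
  exact LocalLog.padicLogOrd_eq_valuation_padicLog W₂ 2 ι P hP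

end OddBlindLocal

end Summit.BirchSwinnertonDyer.BirchSwinnertonDyer.Theorems

end
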